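import Literature.Topology.FourManifolds.SliceDiscEndCollar
import Literature.Topology.FourManifolds.SliceDiscZeroFraming
import Literature.AlgebraicTopology.FundamentalGroup.VanKampenKernel
import Literature.AlgebraicTopology.SingularHomology.MayerVietorisExactness
import Literature.AlgebraicTopology.SingularHomology.ExcisionTheorem
import HarnessLib

/-!
# The open slice-disc exterior `B̊⁴ ∖ Δ`: path connectivity, the meridian, `π₁` and `H₂`

Topic `Literature/Topology/FourManifolds`; groundwork for the fact item
`provefact-Literature.Topology.FourManifolds.Knot.M-9195998579`, the named fact
`Literature.Topology.FourManifolds.Knot.ManolescuPiccirillo2023_lemma33_sphere_core`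
(`ZeroSurgeryHomotopyBallSliceProofs.lean`: Manolescu–Piccirillo (2023), proof of Lemma 3.3 for
`W = S⁴` — the glued manifold `X = X(K') ∪_Y V` is simply connected with `H₂(X; ℤ) = 0`).

For a conical slice disc with its framed conical tube, `D : ConicalDiscTube K`
(`SliceDiscEndCollar.lean`: the disc `Δ = g(𝔻²)`, the trivialised tube `G : D̊² × B(0,2) ↪ B̊⁴` of the
open disc with `G(x, 0) = g x`), the piece `V` of the Manolescu–Piccirillo gluing is the open exterior
`sliceDiscExterior D.g = B̊⁴ ∖ Δ` (the interior of the source's `V = B⁴ ∖ ν(Δ)`). The source disposes of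
its topology in two "routine" sentences ("`π₁(V)` is normally generated by `ι_*(π₁(∂V))`"; "`X` has the
homology type of `W`"). This file proves what the `π₁` and `H₂` computations of `X` need about `V`,
by Seifert–van Kampen and Mayer–Vietoris for the open cover

  `B̊⁴ = U ∪ T`,  `U = B̊⁴ ∖ Δ`,  `T = N = G(D̊² × B(0,2))`,  `U ∩ T = G(D̊² × (B(0,2) ∖ 0))`

of the (convex, hence simply connected and acyclic) open ball, realised inside the type `↥B̊⁴`
(`ballU`, `ballT`):

* `isPathConnected_O`, `pathConnectedSpace_sliceDiscExterior`: **`B̊⁴ ∖ Δ` is path connected**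
  (general position: the bad directions from a point form the `C¹` image of a `3`-dimensional set,
  `ContDiff.dense_compl_range_of_finrank_lt_finrank`).
* `meridianU`, `meridian`: **the meridian** `θ ↦ G(x₀, ½ e^{2πiθ})` of the disc over `x₀ ∈ B̊²`, the
  image of the slice winding loop under the tube map `B̊² × (ℂ ∖ 0) → U ∩ T` (`tubeMap`, the punctured
  plane squeezed radially onto the punctured fibre disc).
* `fromPath_mem_zpowers_meridianU`: loops of `U` inside `T` are powers of the meridian
  (`PuncturedPlane.fromPath_mem_zpowers_slice`: `π₁(ℂ ∖ 0)` is generated by the winding loop).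
* `homotopic_refl_map_of_meridianU`, **`homotopic_refl_map_of_meridian` (Kervaire's lemma for the
  slice-disc exterior)**: a continuous map `φ : B̊⁴ ∖ Δ → Z` sending the meridian into a simply connected
  subset of `Z` kills every loop — `π₁(B̊⁴ ∖ Δ)` is the normal closure of the meridian (van Kampen in
  kernel form, `VanKampen.fromPath_mem_of_homotopic_refl`, Hatcher Thm. 1.20, with `N = ker φ_*`).
* `puncturedTubeEquivCircle`: `U ∩ T ≃ S¹`; hence `H₂(U ∩ T) = 0` (Hatcher Cor. 2.14, proved in the
  tree as `isZero_singularHomology_sphere_holds`).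
* **`isZero_singularHomology_sliceDiscExterior_two`: `H₂(B̊⁴ ∖ Δ; M) = 0`** (Mayer–Vietoris,
  exactness at `H₂(U) ⊕ H₂(T)`, `mayerVietoris.exact₁_holds`).
* **`smul_loopClass_meridian_injective`: the meridian has infinite order in `H₁(B̊⁴ ∖ Δ; ℤ)`**
  (Mayer–Vietoris, exactness at `H₁(U ∩ T)`, `mayerVietoris.exact₃_holds`, `H₁(T) = 0`, and the winding
  functional `loopClass_windingLoop_smul_injective` on the fibre coordinate `fibreCoord`).

These are the two halves of "`B̊⁴ ∖ Δ` is a homology circle generated by the meridian" (Alexander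
duality) that the Manolescu–Piccirillo argument uses, and the `π₁` statement is the slice-disc
analogue of the Wirtinger/Kervaire statement that a knot group is normally generated by a meridian
(in the tree: `Knot.TubularNbhd.normalClosure_meridian_eq_top`, `TwoKnot.normalClosure_meridian_eq_top_holds`).

## References

* C. Manolescu, L. Piccirillo, *From zero surgeries to candidates for exotic definite 4-manifolds*,
  J. Lond. Math. Soc. (2) 108 (2023), §3.2, proof of Lemma 3.3. [ManolescuPiccirillo2023]
* A. Hatcher, *Algebraic Topology*, CUP (2002), Thm. 1.20 (van Kampen), §2.2 pp. 149–150
  (Mayer–Vietoris), Cor. 2.14, Thm. 2A.1 (Hurewicz). [HatcherAT2002]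
* M. Kervaire, *Les nœuds de dimensions supérieures*, Bull. SMF 93 (1965), Ch. I Lemme 1.2 (the model
  for the `π₁` statement).

## Design notes

* The ambient space of the two covers is the open unit ball as a type, `↥(ball 0 1)`, with the pieces
  `ballU = val ⁻¹' O`, `ballT = val ⁻¹' N` (`O`, `N` from `SliceDiscEndCollar.lean`); the results are
  transported to `sliceDiscExterior D.g` at the end along the tautological identification
  (`toExterior`, `ofExterior`, `ballUHomeomorph`).
* The framing clause `D.hasFraming` of the datum is not used in this file.
* No declaration in this file uses `sorry`; no named facts are introduced; no local notation.
-/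

noncomputable section

open Set Metric Function Filter unitInterval
open scoped Topology Manifold ContDiff Real

namespace Literature.Topology.FourManifolds

namespace ConicalDiscTube

variable {K : Knot} (D : ConicalDiscTube K)

/-! ### The tube, the exterior and the punctured tube as subsets of the open ball -/

/-- A tube point lies in the tube neighbourhood `N`. [folklore] -/
theorem G_mem_N {x w : EuclideanSpace ℝ (Fin 2)} (hx : ‖x‖ < 1) (hw : ‖w‖ < 2) : D.G (x, w) ∈ D.N :=
  ⟨(x, w), mem_dom_iff.2 ⟨hx, hw⟩, rfl⟩

/-- A tube point lies in the open unit ball. [folklore] -/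
theorem norm_G_lt_one {x w : EuclideanSpace ℝ (Fin 2)} (hx : ‖x‖ < 1) (hw : ‖w‖ < 2) :
    ‖D.G (x, w)‖ < 1 := by
  have := D.maps_ball (x, w) (mem_dom_iff.2 ⟨hx, hw⟩)
  rwa [mem_ball, dist_zero_right] at this

/-- A tube point off the zero section lies in the exterior `O = B̊⁴ ∖ Δ`. [folklore] -/
theorem G_mem_O {x w : EuclideanSpace ℝ (Fin 2)} (hx : ‖x‖ < 1) (hw : ‖w‖ < 2) (hw0 : w ≠ 0) :
    D.G (x, w) ∈ D.O :=
  ⟨D.norm_G_lt_one hx hw, D.G_not_mem_disc hx hw hw0⟩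

/-- The tube neighbourhood lies in the open unit ball. [folklore] -/
theorem N_subset_ball : D.N ⊆ ball (0 : EuclideanSpace ℝ (Fin 4)) 1 := by
  rintro _ ⟨q, hq, rfl⟩
  exact D.maps_ball q hq

/-- The exterior lies in the open unit ball. [folklore] -/
theorem O_subset_ball : D.O ⊆ ball (0 : EuclideanSpace ℝ (Fin 4)) 1 :=
  fun _ hz ↦ by rw [mem_ball, dist_zero_right]; exact hz.1

/-- **The punctured tube**: the tube neighbourhood meets the exterior exactly in the image of the
punctured fibres, `N ∩ O = G(D̊² × (B(0,2) ∖ 0))`. [folklore] -/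
theorem N_inter_O_eq :
    D.N ∩ D.O = D.G '' (ball (0 : EuclideanSpace ℝ (Fin 2)) 1 ×ˢ (ball (0 : EuclideanSpace ℝ (Fin 2)) 2 \ {0})) := by
  ext z
  constructor
  · rintro ⟨⟨⟨x, w⟩, hq, rfl⟩, hO⟩
    obtain ⟨hx, hw⟩ := mem_dom_iff.1 hq
    refine ⟨(x, w), ⟨by simpa using hx, ⟨by simpa using hw, fun hw0 ↦ ?_⟩⟩, rfl⟩
    have hw0' : w = 0 := hw0
    exact hO.2 (hw0' ▸ D.G_zero_mem_disc hx)
  · rintro ⟨⟨x, w⟩, ⟨hx, hw, hw0⟩, rfl⟩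
    rw [mem_ball, dist_zero_right] at hx hw
    exact ⟨D.G_mem_N hx hw, D.G_mem_O hx hw hw0⟩

/-- **The tube and the exterior cover the open ball**: a point of the disc inside the ball is on the
zero section of the tube. [folklore] -/
theorem ball_subset_N_union_O : ball (0 : EuclideanSpace ℝ (Fin 4)) 1 ⊆ D.N ∪ D.O := by
  intro z hz
  rw [mem_ball, dist_zero_right] at hz
  by_cases hd : z ∈ D.disc
  · obtain ⟨x, hx, rfl⟩ := hd
    rw [mem_closedBall, dist_zero_right] at hx
    rcases hx.lt_or_eq with hlt | heq
    · exact Or.inl ⟨(x, 0), mem_dom_iff.2 ⟨hlt, by simp⟩, D.apply_zero x (by simpa using hlt)⟩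
    · exact absurd (D.norm_g_of_norm_eq_one heq) hz.ne
  · exact Or.inr ⟨hz, hd⟩

/-- The open ball is exactly `N ∪ O`. [folklore] -/
theorem N_union_O_eq : D.N ∪ D.O = ball (0 : EuclideanSpace ℝ (Fin 4)) 1 :=
  Subset.antisymm (union_subset D.N_subset_ball D.O_subset_ball) D.ball_subset_N_union_O

/-- The carrier of the open slice-disc exterior of the conical disc is `O`. [folklore] -/
theorem coe_sliceDiscExterior_eq : (sliceDiscExterior D.g : Set (EuclideanSpace ℝ (Fin 4))) = D.O :=
  Set.ext fun _ ↦ D.mem_exterior_iff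

/-- `G` is continuous on its domain. [folklore] -/
theorem continuousOn_G : ContinuousOn D.G dom := D.contDiffOn.continuousOn

/-- `Ginv` is continuous on the tube neighbourhood. [folklore] -/
theorem continuousOn_Ginv : ContinuousOn D.Ginv D.N := D.contDiffOn_Ginv.continuousOn

/-- The fibre coordinate of an exterior tube point is non-zero. [folklore] -/
theorem Ginv_snd_ne_zero {z : EuclideanSpace ℝ (Fin 4)} (hzN : z ∈ D.N) (hzO : z ∈ D.O) : (D.Ginv z).2 ≠ 0 := by
  intro h0
  have hq := D.Ginv_mem hzN
  have hz : D.G (D.Ginv z) = z := D.G_Ginv hzN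
  rw [← Prod.mk.eta (p := D.Ginv z), h0] at hz
  exact hzO.2 (hz ▸ D.G_zero_mem_disc (mem_dom_iff.1 hq).1)

/-! ### Path connectivity of the exterior -/

/-- The punctured disc `B(0, r) ∖ {0} ⊆ ℝ²` is path connected (the image of `S¹ × (0, r)` under
`(u, t) ↦ t • u`). [folklore] -/
private theorem isPathConnected_ball_diff_zero_aux {r : ℝ} (hr : 0 < r) :
    IsPathConnected (ball (0 : EuclideanSpace ℝ (Fin 2)) r \ {0}) := by
  have hrank : 1 < Module.rank ℝ (EuclideanSpace ℝ (Fin 2)) := by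
    rw [← Module.finrank_eq_rank, finrank_euclideanSpace, Fintype.card_fin]
    norm_num
  have heq : ball (0 : EuclideanSpace ℝ (Fin 2)) r \ {0} =
      (fun p : EuclideanSpace ℝ (Fin 2) × ℝ ↦ p.2 • p.1) ''
        (sphere (0 : EuclideanSpace ℝ (Fin 2)) 1 ×ˢ Ioo 0 r) := by
    ext x
    rw [Set.mem_sdiff, mem_ball_zero_iff, Set.mem_singleton_iff, Set.mem_image]
    constructor
    · rintro ⟨hxr, hx0⟩
      have hpos : 0 < ‖x‖ := norm_pos_iff.2 hx0
      refine ⟨(‖x‖⁻¹ • x, ‖x‖), ⟨?_, hpos, hxr⟩, ?_⟩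
      · rw [mem_sphere_zero_iff_norm, norm_smul, norm_inv, norm_norm, inv_mul_cancel₀ hpos.ne']
      · change ‖x‖ • (‖x‖⁻¹ • x) = x
        rw [smul_smul, mul_inv_cancel₀ hpos.ne', one_smul]
    · rintro ⟨⟨u, t⟩, ⟨hu, ht0, htr⟩, rfl⟩
      rw [mem_sphere_zero_iff_norm] at hu
      change ‖t • u‖ < r ∧ t • u ≠ 0
      rw [norm_smul, Real.norm_of_nonneg (le_of_lt ht0), hu, mul_one]
      exact ⟨htr, smul_ne_zero ht0.ne' (by rintro rfl; simp at hu)⟩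
  rw [heq]
  exact ((isPathConnected_sphere hrank 0 zero_le_one).prod
    ((convex_Ioo 0 r).isPathConnected (nonempty_Ioo.2 hr))).image (continuous_snd.smul continuous_fst)

/-- The punctured tube is path connected. [folklore] -/
theorem isPathConnected_N_inter_O : IsPathConnected (D.N ∩ D.O) := by
  rw [D.N_inter_O_eq]
  have hrank : 1 < Module.rank ℝ (EuclideanSpace ℝ (Fin 2)) := by
    rw [← Module.finrank_eq_rank, finrank_euclideanSpace, Fintype.card_fin]
    norm_num
  refine ((convex_ball (0 : EuclideanSpace ℝ (Fin 2)) 1).isPathConnected ⟨0, by simp⟩).prod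
    (isPathConnected_ball_diff_zero_aux two_pos) |>.image' (D.continuousOn_G.mono ?_)
  rintro ⟨x, w⟩ ⟨hx, hw, -⟩
  exact ⟨hx, hw⟩

/-- **General position off the disc**: every point of the exterior is joined inside the exterior to a
point of the punctured tube by a straight segment. The points `q` for which the segment `[z, q]`
meets the disc form the image of `𝔻² × [1, ∞)` under the `C¹` map `(x, s) ↦ z + s (g x - z)` from a
`3`-dimensional space, whose range has dense complement in `ℝ⁴`
(`ContDiff.dense_compl_range_of_finrank_lt_finrank`), so the open punctured tube contains a good
`q`. [folklore] -/
theorem exists_joinedIn_O {z : EuclideanSpace ℝ (Fin 4)} (hz : z ∈ D.O) :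
    ∃ q ∈ D.N ∩ D.O, JoinedIn D.O z q := by
  -- the bad cone
  let F : EuclideanSpace ℝ (Fin 2) × ℝ → EuclideanSpace ℝ (Fin 4) := fun p ↦ z + p.2 • (D.g p.1 - z)
  have hF : ContDiff ℝ 1 F := by
    have hg : ContDiff ℝ 1 D.g := D.isSliceDisc.1.of_le (by norm_cast)
    exact contDiff_const.add (contDiff_snd.smul ((hg.comp contDiff_fst).sub contDiff_const))
  have hdim : Module.finrank ℝ (EuclideanSpace ℝ (Fin 2) × ℝ) < Module.finrank ℝ (EuclideanSpace ℝ (Fin 4)) := by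
    rw [Module.finrank_prod, finrank_euclideanSpace, finrank_euclideanSpace, Module.finrank_self]
    simp
  have hdense : Dense (range F)ᶜ := hF.dense_compl_range_of_finrank_lt_finrank hdim
  -- a good point in the punctured tube
  have hopen : IsOpen (D.N ∩ D.O) := D.isOpen_N.inter D.isOpen_O
  obtain ⟨q, hqNO, hqF⟩ : ∃ q ∈ D.N ∩ D.O, q ∉ range F := by
    obtain ⟨q, hq⟩ := hdense.inter_open_nonempty _ hopen D.isPathConnected_N_inter_O.nonempty
    exact ⟨q, hq.1, hq.2⟩
  refine ⟨q, hqNO, ?_⟩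
  -- the segment from `z` to `q` runs in `O`
  have hzb : ‖z‖ < 1 := hz.1
  have hqb : ‖q‖ < 1 := hqNO.2.1
  refine JoinedIn.ofLine (f := fun t : ℝ ↦ z + t • (q - z)) (by fun_prop) (by simp) (by simp) ?_
  rintro _ ⟨t, ⟨ht0, ht1⟩, rfl⟩
  refine ⟨?_, fun hd ↦ ?_⟩
  · -- convexity of the ball
    have h := (convex_ball (0 : EuclideanSpace ℝ (Fin 4)) 1).add_smul_sub_mem
      (by simpa using hzb : z ∈ ball (0 : EuclideanSpace ℝ (Fin 4)) 1)
      (by simpa using hqb : q ∈ ball (0 : EuclideanSpace ℝ (Fin 4)) 1) ⟨ht0, ht1⟩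
    simpa using h
  · -- a disc point on the segment puts `q` on the bad cone
    obtain ⟨x, hx, hxe⟩ := hd
    rcases eq_or_lt_of_le ht0 with rfl | ht
    · exact hz.2 ⟨x, hx, by simpa using hxe⟩
    · apply hqF
      refine ⟨(x, t⁻¹), ?_⟩
      simp only [F]
      rw [hxe, show z + t • (q - z) - z = t • (q - z) by abel, smul_smul, inv_mul_cancel₀ ht.ne', one_smul]
      abel

/-- **The exterior `O = B̊⁴ ∖ Δ` of the slice disc is path connected.** [folklore] -/
theorem isPathConnected_O : IsPathConnected D.O := by
  obtain ⟨q₀, hq₀⟩ := D.isPathConnected_N_inter_O.nonempty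
  refine isPathConnected_iff.2 ⟨⟨q₀, hq₀.2⟩, fun z hz z' hz' ↦ ?_⟩
  obtain ⟨q, hq, hzq⟩ := D.exists_joinedIn_O hz
  obtain ⟨q', hq', hzq'⟩ := D.exists_joinedIn_O hz'
  exact (hzq.trans ((D.isPathConnected_N_inter_O.joinedIn q hq q' hq').mono inter_subset_right)).trans
    hzq'.symm

/-- **The open slice-disc exterior is path connected.** [folklore] -/
theorem pathConnectedSpace_sliceDiscExterior : PathConnectedSpace ↥(sliceDiscExterior D.g) := by
  have h : IsPathConnected (sliceDiscExterior D.g : Set (EuclideanSpace ℝ (Fin 4))) := by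
    rw [D.coe_sliceDiscExterior_eq]; exact D.isPathConnected_O
  exact isPathConnected_iff_pathConnectedSpace.1 h

/-! ### The open ball as ambient space: the pieces `U = B̊⁴ ∖ Δ` and `T = N` -/

/-- **the exterior piece of the open ball**, `U = B̊⁴ ∖ Δ` as a subset of the ball [folklore] -/
def ballU : Set ↥(ball (0 : EuclideanSpace ℝ (Fin 4)) 1) := Subtype.val ⁻¹' D.O

/-- **the tube piece of the open ball**, `T = N = G(D̊² × B(0,2))` as a subset of the ball [folklore] -/
def ballT : Set ↥(ball (0 : EuclideanSpace ℝ (Fin 4)) 1) := Subtype.val ⁻¹' D.N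

/-- Membership in `U`. [folklore] -/
theorem mem_ballU_iff {z : ↥(ball (0 : EuclideanSpace ℝ (Fin 4)) 1)} : z ∈ D.ballU ↔ (z : EuclideanSpace ℝ (Fin 4)) ∈ D.O :=
  Iff.rfl

/-- Membership in `T`. [folklore] -/
theorem mem_ballT_iff {z : ↥(ball (0 : EuclideanSpace ℝ (Fin 4)) 1)} : z ∈ D.ballT ↔ (z : EuclideanSpace ℝ (Fin 4)) ∈ D.N :=
  Iff.rfl

/-- `U` is open. [folklore] -/
theorem isOpen_ballU : IsOpen D.ballU := D.isOpen_O.preimage continuous_subtype_val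

/-- `T` is open. [folklore] -/
theorem isOpen_ballT : IsOpen D.ballT := D.isOpen_N.preimage continuous_subtype_val

/-- `U ∪ T` is the whole ball. [folklore] -/
theorem ballU_union_ballT : D.ballU ∪ D.ballT = univ := by
  refine eq_univ_of_forall fun z ↦ ?_
  rcases D.ball_subset_N_union_O z.2 with h | h
  · exact Or.inr h
  · exact Or.inl h

/-- `U` seen in `ℝ⁴` is `O`. [folklore] -/
theorem image_val_ballU : Subtype.val '' D.ballU = D.O := by
  rw [ballU, Subtype.image_preimage_coe, inter_eq_right.2 D.O_subset_ball]

/-- `T` seen in `ℝ⁴` is `N`. [folklore] -/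
theorem image_val_ballT : Subtype.val '' D.ballT = D.N := by
  rw [ballT, Subtype.image_preimage_coe, inter_eq_right.2 D.N_subset_ball]

/-- `U ∩ T` seen in `ℝ⁴` is the punctured tube `N ∩ O`. [folklore] -/
theorem image_val_ballU_inter_ballT : Subtype.val '' (D.ballU ∩ D.ballT) = D.N ∩ D.O := by
  rw [ballU, ballT, ← preimage_inter, Subtype.image_preimage_coe, inter_comm D.O,
    inter_eq_right.2 (inter_subset_left.trans D.N_subset_ball)]

/-- `U` is path connected. [folklore] -/
theorem isPathConnected_ballU : IsPathConnected D.ballU := by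
  rw [Topology.IsInducing.subtypeVal.isPathConnected_iff, D.image_val_ballU]
  exact D.isPathConnected_O

/-- `U ∩ T` is path connected. [folklore] -/
theorem isPathConnected_ballU_inter_ballT : IsPathConnected (D.ballU ∩ D.ballT) := by
  rw [Topology.IsInducing.subtypeVal.isPathConnected_iff, D.image_val_ballU_inter_ballT]
  exact D.isPathConnected_N_inter_O

/-- The open ball is simply connected (it is convex). [folklore] -/
theorem simplyConnectedSpace_ball : SimplyConnectedSpace ↥(ball (0 : EuclideanSpace ℝ (Fin 4)) 1) := by
  haveI := (convex_ball (0 : EuclideanSpace ℝ (Fin 4)) 1).contractibleSpace ⟨0, by simp⟩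
  infer_instance

/-- **the exterior piece of the ball is the open slice-disc exterior** (forward identification) [folklore] -/
def toExterior : C(↥D.ballU, ↥(sliceDiscExterior D.g)) where
  toFun u := ⟨((u : ↥(ball (0 : EuclideanSpace ℝ (Fin 4)) 1)) : EuclideanSpace ℝ (Fin 4)), D.mem_exterior_iff.2 u.2⟩
  continuous_toFun := (continuous_subtype_val.comp continuous_subtype_val).subtype_mk _

/-- **the open slice-disc exterior is the exterior piece of the ball** (backward identification) [folklore] -/
def ofExterior : C(↥(sliceDiscExterior D.g), ↥D.ballU) where
  toFun v := ⟨⟨(v : EuclideanSpace ℝ (Fin 4)), D.O_subset_ball (D.mem_exterior_iff.1 v.2)⟩, D.mem_exterior_iff.1 v.2⟩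
  continuous_toFun := (continuous_subtype_val.subtype_mk _).subtype_mk _

/-- Value of `toExterior`. [folklore] -/
@[simp] theorem coe_toExterior (u : ↥D.ballU) :
    (D.toExterior u : EuclideanSpace ℝ (Fin 4)) = ((u : ↥(ball (0 : EuclideanSpace ℝ (Fin 4)) 1)) : EuclideanSpace ℝ (Fin 4)) := rfl

/-- Value of `ofExterior`. [folklore] -/
@[simp] theorem coe_coe_ofExterior (v : ↥(sliceDiscExterior D.g)) :
    (((D.ofExterior v : ↥D.ballU) : ↥(ball (0 : EuclideanSpace ℝ (Fin 4)) 1)) : EuclideanSpace ℝ (Fin 4)) = (v : EuclideanSpace ℝ (Fin 4)) := rfl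

/-- `toExterior ∘ ofExterior = id`. [folklore] -/
@[simp] theorem toExterior_ofExterior (v : ↥(sliceDiscExterior D.g)) : D.toExterior (D.ofExterior v) = v := rfl

/-- `ofExterior ∘ toExterior = id`. [folklore] -/
@[simp] theorem ofExterior_toExterior (u : ↥D.ballU) : D.ofExterior (D.toExterior u) = u := rfl

/-! ### The tube map `B̊² × (ℂ ∖ 0) → U ∩ T` and the meridian -/

/-- **radial squeeze of the plane onto the disc of radius `2`**: `w ↦ 2w/(1 + ‖w‖)` [folklore] -/
def kap (w : EuclideanSpace ℝ (Fin 2)) : EuclideanSpace ℝ (Fin 2) := (2 / (1 + ‖w‖)) • w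

/-- **the inverse of the squeeze on `B(0,2)`**: `w ↦ w/(2 - ‖w‖)` [folklore] -/
def kapInv (w : EuclideanSpace ℝ (Fin 2)) : EuclideanSpace ℝ (Fin 2) := (1 / (2 - ‖w‖)) • w

/-- `‖kap w‖ = 2‖w‖/(1 + ‖w‖)`. [folklore] -/
theorem norm_kap (w : EuclideanSpace ℝ (Fin 2)) : ‖kap w‖ = 2 * ‖w‖ / (1 + ‖w‖) := by
  rw [kap, norm_smul, Real.norm_of_nonneg (by positivity)]
  ring

/-- `‖kap w‖ < 2`. [folklore] -/
theorem norm_kap_lt (w : EuclideanSpace ℝ (Fin 2)) : ‖kap w‖ < 2 := by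
  rw [norm_kap, div_lt_iff₀ (by positivity)]
  linarith [norm_nonneg w]

/-- `kap w ≠ 0` for `w ≠ 0`. [folklore] -/
theorem kap_ne_zero {w : EuclideanSpace ℝ (Fin 2)} (hw : w ≠ 0) : kap w ≠ 0 :=
  smul_ne_zero (by positivity : (0 : ℝ) < 2 / (1 + ‖w‖)).ne' hw

/-- `kap` is continuous. [folklore] -/
theorem continuous_kap : Continuous kap := by
  unfold kap
  exact (continuous_const.div (continuous_const.add continuous_norm)
    fun w ↦ (by positivity : (0 : ℝ) < 1 + ‖w‖).ne').smul continuous_id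

/-- `kap (kapInv w) = w` on `B(0, 2)`. [folklore] -/
theorem kap_kapInv {w : EuclideanSpace ℝ (Fin 2)} (hw : ‖w‖ < 2) : kap (kapInv w) = w := by
  have h2 : 0 < 2 - ‖w‖ := by linarith
  rw [kapInv, kap, norm_smul, Real.norm_of_nonneg (by positivity), smul_smul]
  have : 2 / (1 + 1 / (2 - ‖w‖) * ‖w‖) * (1 / (2 - ‖w‖)) = 1 := by
    field_simp
    ring
  rw [this, one_smul]

/-- `kapInv (kap w) = w`. [folklore] -/
theorem kapInv_kap (w : EuclideanSpace ℝ (Fin 2)) : kapInv (kap w) = w := by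
  have h1 : 0 < 1 + ‖w‖ := by positivity
  rw [kapInv, norm_kap, kap, smul_smul]
  have : 1 / (2 - 2 * ‖w‖ / (1 + ‖w‖)) * (2 / (1 + ‖w‖)) = 1 := by
    field_simp
    ring
  rw [this, one_smul]

/-- `kapInv w ≠ 0` for `w ≠ 0`, `‖w‖ < 2`. [folklore] -/
theorem kapInv_ne_zero {w : EuclideanSpace ℝ (Fin 2)} (hw : ‖w‖ < 2) (hw0 : w ≠ 0) : kapInv w ≠ 0 :=
  smul_ne_zero (by have : 0 < 2 - ‖w‖ := by linarith
                   positivity) hw0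

/-- `kapInv` is continuous on `B(0, 2)`. [folklore] -/
theorem continuousOn_kapInv : ContinuousOn kapInv (ball (0 : EuclideanSpace ℝ (Fin 2)) 2) := by
  unfold kapInv
  refine ContinuousOn.smul (continuousOn_const.div (continuousOn_const.sub continuous_norm.continuousOn)
    fun w hw ↦ ?_) continuousOn_id
  rw [mem_ball_zero_iff] at hw
  exact (by linarith : (0 : ℝ) < 2 - ‖w‖).ne'

/-- The squeeze takes the circle of radius `1/3` to the circle of radius `1/2`. [folklore] -/
theorem kap_third_smul {u : EuclideanSpace ℝ (Fin 2)} (hu : ‖u‖ = 1) :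
    kap ((1 / 3 : ℝ) • u) = (1 / 2 : ℝ) • u := by
  rw [kap, norm_smul, hu, mul_one, Real.norm_of_nonneg (by norm_num), smul_smul]
  norm_num

open Literature.AlgebraicTopology.FundamentalGroup.PuncturedPlane PlaneComplex

/-- **the tube map** `Φ : B̊² × (ℂ ∖ 0) → U`, `(x, ζ) ↦ G(x, κ ζ)` (plane identified with `ℂ`, the
punctured plane squeezed onto the punctured fibre disc `B(0,2) ∖ 0`); its image is the punctured
tube `U ∩ T`. [folklore] -/
def tubeMap : C(↥(ball (0 : EuclideanSpace ℝ (Fin 2)) 1) × CStar, ↥D.ballU) where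
  toFun a := ⟨⟨D.G ((a.1 : EuclideanSpace ℝ (Fin 2)), kap (ofC (a.2 : ℂ))),
    D.norm_G_lt_one (mem_ball_zero_iff.1 a.1.2) (norm_kap_lt _) |> fun h ↦ mem_ball_zero_iff.2 h⟩,
    D.G_mem_O (mem_ball_zero_iff.1 a.1.2) (norm_kap_lt _) (kap_ne_zero (ofC_ne_zero a.2.2))⟩
  continuous_toFun := by
    refine Continuous.subtype_mk (Continuous.subtype_mk ?_ _) _
    refine D.continuousOn_G.comp_continuous
      ((continuous_subtype_val.comp continuous_fst).prodMk
        (continuous_kap.comp (continuous_ofC.comp (continuous_subtype_val.comp continuous_snd))))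
      fun a ↦ mem_dom_iff.2 ⟨?_, norm_kap_lt _⟩
    exact mem_ball_zero_iff.1 a.1.2

/-- Value of the tube map in `ℝ⁴`. [folklore] -/
theorem coe_tubeMap (a : ↥(ball (0 : EuclideanSpace ℝ (Fin 2)) 1) × CStar) :
    (((D.tubeMap a : ↥D.ballU) : ↥(ball (0 : EuclideanSpace ℝ (Fin 4)) 1)) : EuclideanSpace ℝ (Fin 4)) =
      D.G ((a.1 : EuclideanSpace ℝ (Fin 2)), kap (ofC (a.2 : ℂ))) := rfl

/-- The tube map lands in `T`. [folklore] -/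
theorem tubeMap_mem_ballT (a : ↥(ball (0 : EuclideanSpace ℝ (Fin 2)) 1) × CStar) :
    ((D.tubeMap a : ↥D.ballU) : ↥(ball (0 : EuclideanSpace ℝ (Fin 4)) 1)) ∈ D.ballT :=
  D.G_mem_N (mem_ball_zero_iff.1 a.1.2) (norm_kap_lt _)

/-- `1/3 > 0`. [folklore] -/
theorem one_third_pos : (0 : ℝ) < 1 / 3 := by norm_num

/-- **the base point** `G(x₀, ½ e₀)` of the meridian over `x₀ ∈ B̊²`, in `U` [folklore] -/
def basePt {x₀ : EuclideanSpace ℝ (Fin 2)} (hx₀ : ‖x₀‖ < 1) : ↥D.ballU :=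
  D.tubeMap (⟨x₀, mem_ball_zero_iff.2 hx₀⟩, bpt (1 / 3) one_third_pos)

/-- **the meridian of the disc over `x₀`**: the loop `θ ↦ G(x₀, ½ e^{2πiθ})` of `U`, the image of the
slice winding loop of radius `1/3` under the tube map [folklore] -/
def meridianU {x₀ : EuclideanSpace ℝ (Fin 2)} (hx₀ : ‖x₀‖ < 1) : Path (D.basePt hx₀) (D.basePt hx₀) :=
  (sliceWindingLoop (⟨x₀, mem_ball_zero_iff.2 hx₀⟩ : ↥(ball (0 : EuclideanSpace ℝ (Fin 2)) 1)) (1 / 3)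
    one_third_pos).map D.tubeMap.continuous

/-- Value of the meridian at `θ`: `G(x₀, ½ e^{2πiθ})`, i.e. `G(x₀, fibreVec θ)`. [folklore] -/
theorem coe_meridianU {x₀ : EuclideanSpace ℝ (Fin 2)} (hx₀ : ‖x₀‖ < 1) (θ : unitInterval) :
    (((D.meridianU hx₀ θ : ↥D.ballU) : ↥(ball (0 : EuclideanSpace ℝ (Fin 4)) 1)) : EuclideanSpace ℝ (Fin 4)) =
      D.G (x₀, Knot.TubularNbhd.fibreVec θ) := by
  change D.G (x₀, kap (ofC ((windingLoop (1 / 3) one_third_pos 1 θ : CStar) : ℂ))) = _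
  rw [windingLoop_apply_coe, ofC_polar, kap_third_smul (norm_eq_of_mem_sphere _), Knot.TubularNbhd.fibreVec]
  congr 2
  ring_nf

/-- Value of the base point: `G(x₀, ½ e₀) = G(x₀, fibreVec 0)`. [folklore] -/
theorem coe_basePt {x₀ : EuclideanSpace ℝ (Fin 2)} (hx₀ : ‖x₀‖ < 1) :
    (((D.basePt hx₀ : ↥D.ballU) : ↥(ball (0 : EuclideanSpace ℝ (Fin 4)) 1)) : EuclideanSpace ℝ (Fin 4)) =
      D.G (x₀, Knot.TubularNbhd.fibreVec 0) := by
  rw [← D.coe_meridianU hx₀ 0, (D.meridianU hx₀).source]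

/-- The base point lies in `T`. [folklore] -/
theorem basePt_mem_ballT {x₀ : EuclideanSpace ℝ (Fin 2)} (hx₀ : ‖x₀‖ < 1) :
    ((D.basePt hx₀ : ↥D.ballU) : ↥(ball (0 : EuclideanSpace ℝ (Fin 4)) 1)) ∈ D.ballT :=
  D.tubeMap_mem_ballT _

/-- The meridian runs in `T`. [folklore] -/
theorem meridianU_mem_ballT {x₀ : EuclideanSpace ℝ (Fin 2)} (hx₀ : ‖x₀‖ < 1) (θ : unitInterval) :
    ((D.meridianU hx₀ θ : ↥D.ballU) : ↥(ball (0 : EuclideanSpace ℝ (Fin 4)) 1)) ∈ D.ballT :=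
  D.tubeMap_mem_ballT _

/-- **Loops of `U` inside the tube are powers of the meridian.** A loop of `U = B̊⁴ ∖ Δ` at the base
point which stays in the tube `T` is, in `π₁(U)`, a power of the meridian: pulled back through `G` it
is a loop of `B̊² × (B(0,2) ∖ 0) ≅ B̊² × (ℂ ∖ 0)`, whose fundamental group is generated by the slice
winding loop (`PuncturedPlane.fromPath_mem_zpowers_slice`, the covering `exp`). [folklore] -/
theorem fromPath_mem_zpowers_meridianU {x₀ : EuclideanSpace ℝ (Fin 2)} (hx₀ : ‖x₀‖ < 1)
    (δ : Path (D.basePt hx₀) (D.basePt hx₀))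
    (hδ : ∀ t, ((δ t : ↥D.ballU) : ↥(ball (0 : EuclideanSpace ℝ (Fin 4)) 1)) ∈ D.ballT) :
    FundamentalGroup.fromPath (Path.Homotopic.Quotient.mk δ) ∈
      Subgroup.zpowers (FundamentalGroup.fromPath (Path.Homotopic.Quotient.mk (D.meridianU hx₀))) := by
  haveI : SimplyConnectedSpace ↥(ball (0 : EuclideanSpace ℝ (Fin 2)) 1) := by
    haveI := (convex_ball (0 : EuclideanSpace ℝ (Fin 2)) 1).contractibleSpace ⟨0, by simp⟩
    infer_instance
  -- the loop in tube coordinates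
  let z : unitInterval → EuclideanSpace ℝ (Fin 4) := fun t ↦
    (((δ t : ↥D.ballU) : ↥(ball (0 : EuclideanSpace ℝ (Fin 4)) 1)) : EuclideanSpace ℝ (Fin 4))
  have hz : Continuous z := (continuous_subtype_val.comp continuous_subtype_val).comp δ.continuous
  have hzN : ∀ t, z t ∈ D.N := hδ
  have hzO : ∀ t, z t ∈ D.O := fun t ↦ (δ t).2
  let q : unitInterval → EuclideanSpace ℝ (Fin 2) × EuclideanSpace ℝ (Fin 2) := fun t ↦ D.Ginv (z t)
  have hq : Continuous q := D.continuousOn_Ginv.comp_continuous hz hzN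
  have hqdom : ∀ t, q t ∈ (dom : Set (EuclideanSpace ℝ (Fin 2) × EuclideanSpace ℝ (Fin 2))) := fun t ↦ D.Ginv_mem (hzN t)
  have hGq : ∀ t, D.G (q t) = z t := fun t ↦ D.G_Ginv (hzN t)
  have hq1 : ∀ t, ‖(q t).1‖ < 1 := fun t ↦ (mem_dom_iff.1 (hqdom t)).1
  have hq2 : ∀ t, ‖(q t).2‖ < 2 := fun t ↦ (mem_dom_iff.1 (hqdom t)).2
  have hq0 : ∀ t, (q t).2 ≠ 0 := fun t ↦ D.Ginv_snd_ne_zero (hzN t) (hzO t)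
  -- end points
  have hends : ∀ t, z t = D.G (x₀, Knot.TubularNbhd.fibreVec 0) → q t = (x₀, Knot.TubularNbhd.fibreVec 0) := by
    intro t ht
    change D.Ginv (z t) = _
    rw [ht]
    exact D.Ginv_apply (mem_dom_iff.2 ⟨hx₀, by
      rw [Knot.TubularNbhd.norm_fibreVec]; norm_num⟩)
  have hz0 : z 0 = D.G (x₀, Knot.TubularNbhd.fibreVec 0) := by
    change (((δ 0 : ↥D.ballU) : ↥(ball (0 : EuclideanSpace ℝ (Fin 4)) 1)) : EuclideanSpace ℝ (Fin 4)) = _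
    rw [δ.source, D.coe_basePt]
  have hz1 : z 1 = D.G (x₀, Knot.TubularNbhd.fibreVec 0) := by
    change (((δ 1 : ↥D.ballU) : ↥(ball (0 : EuclideanSpace ℝ (Fin 4)) 1)) : EuclideanSpace ℝ (Fin 4)) = _
    rw [δ.target, D.coe_basePt]
  have hfib : toC (kapInv (Knot.TubularNbhd.fibreVec 0)) = ((1 / 3 : ℝ) : ℂ) := by
    have h1 : kapInv (Knot.TubularNbhd.fibreVec 0) = (1 / 3 : ℝ) • ((circlePoint 0 : Metric.sphere (0 : EuclideanSpace ℝ (Fin 2)) 1) : EuclideanSpace ℝ (Fin 2)) := by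
      have e : Knot.TubularNbhd.fibreVec 0 = kap ((1 / 3 : ℝ) • ((circlePoint 0 : Metric.sphere (0 : EuclideanSpace ℝ (Fin 2)) 1) : EuclideanSpace ℝ (Fin 2))) := by
        rw [kap_third_smul (norm_eq_of_mem_sphere _), Knot.TubularNbhd.fibreVec]
        simp
      rw [e, kapInv_kap]
    rw [h1, toC_polar]
    simp
  -- the loop in `B̊² × (ℂ ∖ 0)`
  let b : ↥(ball (0 : EuclideanSpace ℝ (Fin 2)) 1) × CStar :=
    (⟨x₀, mem_ball_zero_iff.2 hx₀⟩, bpt (1 / 3) one_third_pos)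
  let β : Path b b :=
    { toFun := fun t ↦ (⟨(q t).1, mem_ball_zero_iff.2 (hq1 t)⟩,
        ⟨toC (kapInv (q t).2), toC_ne_zero (kapInv_ne_zero (hq2 t) (hq0 t))⟩)
      continuous_toFun := by
        refine ((continuous_fst.comp hq).subtype_mk _).prodMk (Continuous.subtype_mk ?_ _)
        exact continuous_toC.comp (continuousOn_kapInv.comp_continuous (continuous_snd.comp hq)
          fun t ↦ mem_ball_zero_iff.2 (hq2 t))
      source' := by
        refine Prod.ext (Subtype.ext ?_) (Subtype.ext ?_)
        · change (q 0).1 = x₀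
          rw [hends 0 hz0]
        · change toC (kapInv (q 0).2) = ((1 / 3 : ℝ) : ℂ)
          rw [hends 0 hz0]
          exact hfib
      target' := by
        refine Prod.ext (Subtype.ext ?_) (Subtype.ext ?_)
        · change (q 1).1 = x₀
          rw [hends 1 hz1]
        · change toC (kapInv (q 1).2) = ((1 / 3 : ℝ) : ℂ)
          rw [hends 1 hz1]
          exact hfib }
  have hδβ : ∀ t, δ t = D.tubeMap (β t) := fun t ↦ by
    apply Subtype.ext
    apply Subtype.ext
    change z t = D.G ((q t).1, kap (ofC (toC (kapInv (q t).2))))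
    rw [ofC_toC, kap_kapInv (hq2 t), Prod.mk.eta, hGq]
  have hb : D.tubeMap b = D.basePt hx₀ := rfl
  have e1 := FundamentalGroup.mapOfEq_fromPath_eq D.tubeMap hb β δ hδβ
  have e2 := FundamentalGroup.mapOfEq_fromPath_eq D.tubeMap hb
    (sliceWindingLoop (⟨x₀, mem_ball_zero_iff.2 hx₀⟩ : ↥(ball (0 : EuclideanSpace ℝ (Fin 2)) 1)) (1 / 3)
      one_third_pos) (D.meridianU hx₀) (fun t ↦ rfl)
  obtain ⟨k, hk⟩ := Subgroup.mem_zpowers_iff.1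
    (fromPath_mem_zpowers_slice (⟨x₀, mem_ball_zero_iff.2 hx₀⟩ : ↥(ball (0 : EuclideanSpace ℝ (Fin 2)) 1))
      (1 / 3) one_third_pos β)
  rw [← e1, ← hk, map_zpow, e2]
  exact Subgroup.zpow_mem _ (Subgroup.mem_zpowers _) k

/-! ### The meridian on the open slice-disc exterior -/

/-- **the meridian of the slice disc** as a loop of the open slice-disc exterior `sliceDiscExterior D.g`:
`θ ↦ G(x₀, ½ e^{2πiθ})` [folklore] -/
def meridian {x₀ : EuclideanSpace ℝ (Fin 2)} (hx₀ : ‖x₀‖ < 1) :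
    Path (D.toExterior (D.basePt hx₀)) (D.toExterior (D.basePt hx₀)) :=
  (D.meridianU hx₀).map D.toExterior.continuous

/-- Value of the meridian: `G(x₀, fibreVec θ) = G(x₀, ½ e^{2πiθ})`. [folklore] -/
@[simp] theorem coe_meridian {x₀ : EuclideanSpace ℝ (Fin 2)} (hx₀ : ‖x₀‖ < 1) (θ : unitInterval) :
    (D.meridian hx₀ θ : EuclideanSpace ℝ (Fin 4)) = D.G (x₀, Knot.TubularNbhd.fibreVec θ) :=
  D.coe_meridianU hx₀ θ

/-- The meridian as a loop of `U` again: `ofExterior ∘ meridian = meridianU`. [folklore] -/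
theorem meridian_map_ofExterior {x₀ : EuclideanSpace ℝ (Fin 2)} (hx₀ : ‖x₀‖ < 1) :
    (D.meridian hx₀).map D.ofExterior.continuous = D.meridianU hx₀ := by
  ext t
  rfl

/-! ### Kervaire's lemma: a map killing the meridian kills `π₁(B̊⁴ ∖ Δ)` -/

/-- A loop lying in a simply connected subset is null-homotopic. [folklore] -/
theorem homotopic_refl_of_forall_mem {Z : Type*} [TopologicalSpace Z] {S : Set Z} (hS : IsSimplyConnected S)
    {z : Z} (p : Path z z) (hp : ∀ t, p t ∈ S) : p.Homotopic (Path.refl z) := by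
  obtain ⟨F, -⟩ := (isSimplyConnected_iff_exists_homotopy_refl_forall_mem.1 hS).2 z p hp
  exact ⟨F⟩

/-- **Kervaire's lemma for the slice-disc exterior, base-point form.** Let `φ : U → Z` be continuous on
`U = B̊⁴ ∖ Δ` and suppose that `φ` maps the meridian over `x₀` into a simply connected subset `S ⊆ Z`.
Then `φ` kills every loop of `U` at the base point. Proof: Seifert–van Kampen in kernel form
(`VanKampen.fromPath_mem_of_homotopic_refl`, Hatcher (2002), Thm. 1.20) for the simply connected ball
`B̊⁴ = U ∪ T`, `T` the tube neighbourhood of the open disc, with `N = ker φ_*`: loops of `U` inside `T`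
are powers of the meridian (`fromPath_mem_zpowers_meridianU`), which lies in `N`. In other words
`π₁(B̊⁴ ∖ Δ)` is the normal closure of the meridian (the slice-disc analogue of the Wirtinger / Kervaire
statement for knot and 2-knot groups; Manolescu–Piccirillo: "`π₁(V)` is normally generated by
`ι_*(π₁(∂V))`"). [cite: ManolescuPiccirillo2023, §3.2, proof of Lemma 3.3] [cite: HatcherAT2002, Thm. 1.20] -/
theorem homotopic_refl_map_of_meridianU {Z : Type*} [TopologicalSpace Z] (φ : C(↥D.ballU, Z)) {S : Set Z}
    (hS : IsSimplyConnected S) {x₀ : EuclideanSpace ℝ (Fin 2)} (hx₀ : ‖x₀‖ < 1)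
    (hmer : ∀ t, φ (D.meridianU hx₀ t) ∈ S) (γ : Path (D.basePt hx₀) (D.basePt hx₀)) :
    (γ.map φ.continuous).Homotopic (Path.refl _) := by
  haveI : SimplyConnectedSpace ↥(ball (0 : EuclideanSpace ℝ (Fin 4)) 1) := simplyConnectedSpace_ball
  have h0 : φ (D.basePt hx₀) = φ (D.basePt hx₀) := rfl
  let N : Subgroup (FundamentalGroup (↥D.ballU) (D.basePt hx₀)) := (FundamentalGroup.mapOfEq φ h0).ker
  have key : ∀ δ : Path (D.basePt hx₀) (D.basePt hx₀),
      FundamentalGroup.fromPath (Path.Homotopic.Quotient.mk δ) ∈ N ↔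
        (δ.map φ.continuous).Homotopic (Path.refl _) := by
    intro δ
    rw [MonoidHom.mem_ker, FundamentalGroup.mapOfEq_fromPath_eq φ h0 δ (δ.map φ.continuous) (fun t ↦ rfl),
      FundamentalGroup.one_def]
    exact Path.Homotopic.Quotient.eq
  have hm : FundamentalGroup.fromPath (Path.Homotopic.Quotient.mk (D.meridianU hx₀)) ∈ N :=
    (key _).2 (homotopic_refl_of_forall_mem hS _ hmer)
  have hN : ∀ δ : Path (D.basePt hx₀) (D.basePt hx₀),
      (∀ t, ((δ t : ↥D.ballU) : ↥(ball (0 : EuclideanSpace ℝ (Fin 4)) 1)) ∈ D.ballT) →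
        FundamentalGroup.fromPath (Path.Homotopic.Quotient.mk δ) ∈ N :=
    fun δ hδ ↦ (Subgroup.zpowers_le.2 hm) (D.fromPath_mem_zpowers_meridianU hx₀ δ hδ)
  have hnull : (γ.map continuous_subtype_val).Homotopic (Path.refl _) :=
    SimplyConnectedSpace.paths_homotopic _ _
  have hγ := Literature.AlgebraicTopology.FundamentalGroup.VanKampen.fromPath_mem_of_homotopic_refl
    (Y := ↥(ball (0 : EuclideanSpace ℝ (Fin 4)) 1)) (U := D.ballU) (T := D.ballT)
    D.isOpen_ballU D.isOpen_ballT D.ballU_union_ballT D.isPathConnected_ballU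
    D.isPathConnected_ballU_inter_ballT (D.basePt hx₀).2 (D.basePt_mem_ballT hx₀) N hN γ hnull
  exact (key γ).1 hγ

/-- `U` is path connected, as a space. [folklore] -/
theorem pathConnectedSpace_ballU : PathConnectedSpace ↥D.ballU :=
  isPathConnected_iff_pathConnectedSpace.1 D.isPathConnected_ballU

/-- **Kervaire's lemma for the slice-disc exterior.** Let `V = B̊⁴ ∖ Δ` be the open exterior of the
conical slice disc (`sliceDiscExterior D.g`), `φ : V → Z` continuous, and suppose `φ` maps the meridian
of the disc over some `x₀ ∈ B̊²` into a simply connected subset of `Z`. Then `φ ∘ γ` is null-homotopic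
for every loop `γ` of `V`, at every base point (`π₁(V)` is normally generated by the meridian;
base-point form `homotopic_refl_map_of_meridianU` plus change of base point).
[cite: ManolescuPiccirillo2023, §3.2, proof of Lemma 3.3] [cite: HatcherAT2002, Thm. 1.20] -/
theorem homotopic_refl_map_of_meridian {Z : Type*} [TopologicalSpace Z]
    (φ : C(↥(sliceDiscExterior D.g), Z)) {S : Set Z} (hS : IsSimplyConnected S)
    {x₀ : EuclideanSpace ℝ (Fin 2)} (hx₀ : ‖x₀‖ < 1) (hmer : ∀ t, φ (D.meridian hx₀ t) ∈ S)
    {v : ↥(sliceDiscExterior D.g)} (γ : Path v v) :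
    (γ.map φ.continuous).Homotopic (Path.refl (φ v)) := by
  haveI := D.pathConnectedSpace_ballU
  let φ' : C(↥D.ballU, Z) := φ.comp D.toExterior
  have hmer' : ∀ t, φ' (D.meridianU hx₀ t) ∈ S := fun t ↦ hmer t
  let α : Path (D.basePt hx₀) (D.ofExterior v) := PathConnectedSpace.somePath _ _
  let γ' : Path (D.ofExterior v) (D.ofExterior v) := γ.map D.ofExterior.continuous
  have h1 := D.homotopic_refl_map_of_meridianU φ' hS hx₀ hmer' ((α.trans γ').trans α.symm)
  rw [Path.map_trans, Path.map_trans, ← Path.map_symm] at h1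
  have h2 := Path.Homotopic.refl_of_conj (α.map φ'.continuous) h1
  have e : γ'.map φ'.continuous = γ.map φ.continuous := by
    ext t
    rfl
  rwa [e] at h2

/-! ### Homology: `H₂(B̊⁴ ∖ Δ) = 0` and the meridian has infinite order in `H₁(B̊⁴ ∖ Δ)` -/

section Homology

open CategoryTheory Limits Literature.AlgebraicTopology.SingularHomology
  Literature.AlgebraicTopology.SingularHomology.SingularSimplex

universe v

variable (R : Type v) [CommRing R] (M : Type v) [AddCommGroup M] [Module R M]

/-- The interiors of `U` and `T` cover the ball. [folklore] -/
theorem interior_ballU_union_interior_ballT : interior D.ballU ∪ interior D.ballT = univ := by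
  rw [D.isOpen_ballU.interior_eq, D.isOpen_ballT.interior_eq, D.ballU_union_ballT]

/-- The open ball has no homology in positive degrees. [folklore] -/
theorem isZero_singularHomology_ball {n : ℕ} (hn : n ≠ 0) :
    IsZero (singularHomology R M ↥(ball (0 : EuclideanSpace ℝ (Fin 4)) 1) n) := by
  haveI := (convex_ball (0 : EuclideanSpace ℝ (Fin 4)) 1).contractibleSpace ⟨0, by simp⟩
  exact isZero_singularHomology_of_contractibleSpace R M hn

/-- **the tube piece is a copy of its domain**: `T ≅ D̊² × B(0,2)` through `G` [folklore] -/
def ballTHomeomorph : ↥D.ballT ≃ₜ ↥(dom : Set (EuclideanSpace ℝ (Fin 2) × EuclideanSpace ℝ (Fin 2))) where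
  toFun z := ⟨D.Ginv ((z : ↥(ball (0 : EuclideanSpace ℝ (Fin 4)) 1)) : EuclideanSpace ℝ (Fin 4)), D.Ginv_mem z.2⟩
  invFun q := ⟨⟨D.G q, D.maps_ball q q.2⟩, ⟨q, q.2, rfl⟩⟩
  left_inv z := Subtype.ext (Subtype.ext (D.G_Ginv z.2))
  right_inv q := Subtype.ext (D.Ginv_apply q.2)
  continuous_toFun := (D.continuousOn_Ginv.comp_continuous (continuous_subtype_val.comp continuous_subtype_val)
    fun z ↦ z.2).subtype_mk _
  continuous_invFun := ((D.continuousOn_G.comp_continuous continuous_subtype_val fun q ↦ q.2).subtype_mk _).subtype_mk _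

/-- The tube piece is contractible. [folklore] -/
theorem contractibleSpace_ballT : ContractibleSpace ↥D.ballT := by
  haveI : ContractibleSpace ↥(dom : Set (EuclideanSpace ℝ (Fin 2) × EuclideanSpace ℝ (Fin 2))) :=
    ((convex_ball (0 : EuclideanSpace ℝ (Fin 2)) 1).prod (convex_ball (0 : EuclideanSpace ℝ (Fin 2)) 2)).contractibleSpace
      ⟨(0, 0), mem_dom_iff.2 ⟨by simp, by simp⟩⟩
  exact D.ballTHomeomorph.contractibleSpace

/-- The tube piece has no homology in positive degrees. [folklore] -/
theorem isZero_singularHomology_ballT {n : ℕ} (hn : n ≠ 0) : IsZero (singularHomology R M ↥D.ballT n) := by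
  haveI := D.contractibleSpace_ballT
  exact isZero_singularHomology_of_contractibleSpace R M hn

/-- A point of the punctured tube `U ∩ T` over `x₀`: `G(x₀, w)`, `0 < ‖w‖ < 2`. [folklore] -/
theorem G_mem_ballU_inter_ballT {x₀ w : EuclideanSpace ℝ (Fin 2)} (hx₀ : ‖x₀‖ < 1) (hw : ‖w‖ < 2) (hw0 : w ≠ 0) :
    (⟨D.G (x₀, w), mem_ball_zero_iff.2 (D.norm_G_lt_one hx₀ hw)⟩ : ↥(ball (0 : EuclideanSpace ℝ (Fin 4)) 1)) ∈
      D.ballU ∩ D.ballT :=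
  ⟨D.G_mem_O hx₀ hw hw0, D.G_mem_N hx₀ hw⟩

/-- **the punctured tube is homotopy equivalent to the circle**: `U ∩ T ≅ D̊² × (B(0,2) ∖ 0) ≃ S¹`, by
the direction of the fibre coordinate one way and the circle of radius `½` in the fibre over the centre
the other way (straight-line homotopy in the convex base and the star-shaped punctured fibre) [folklore] -/
def puncturedTubeEquivCircle :
    ContinuousMap.HomotopyEquiv ↥(D.ballU ∩ D.ballT) (Metric.sphere (0 : EuclideanSpace ℝ (Fin 2)) 1) where
  toFun := ⟨fun z ↦ radialProjection (spherePt 1)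
      (D.Ginv ((z : ↥(ball (0 : EuclideanSpace ℝ (Fin 4)) 1)) : EuclideanSpace ℝ (Fin 4))).2,
    (continuousOn_radialProjection (spherePt 1)).comp_continuous
      (continuous_snd.comp (D.continuousOn_Ginv.comp_continuous
        (continuous_subtype_val.comp continuous_subtype_val) fun z ↦ z.2.2))
      fun z ↦ D.Ginv_snd_ne_zero z.2.2 z.2.1⟩
  invFun := ⟨fun u ↦ ⟨_, D.G_mem_ballU_inter_ballT (x₀ := 0) (w := (1 / 2 : ℝ) • (u : EuclideanSpace ℝ (Fin 2)))
      (by simp) (by rw [norm_smul_coe_sphere (by norm_num)]; norm_num)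
      (smul_ne_zero (by norm_num) (ne_zero_of_mem_unit_sphere u))⟩,
    by
      refine Continuous.subtype_mk (Continuous.subtype_mk ?_ _) _
      have hc : Continuous fun u : Metric.sphere (0 : EuclideanSpace ℝ (Fin 2)) 1 ↦
          ((0 : EuclideanSpace ℝ (Fin 2)), (1 / 2 : ℝ) • (u : EuclideanSpace ℝ (Fin 2))) := by
        fun_prop
      exact D.continuousOn_G.comp_continuous hc
        fun u ↦ mem_dom_iff.2 ⟨by simp, by rw [norm_smul_coe_sphere (by norm_num)]; norm_num⟩⟩
  left_inv := by
    -- the straight-line homotopy `s ↦ G((1-s) x, ((1-s) + s/(2‖w‖)) w)` from the identity to the retraction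
    let q : ↥(D.ballU ∩ D.ballT) → EuclideanSpace ℝ (Fin 2) × EuclideanSpace ℝ (Fin 2) := fun z ↦
      D.Ginv ((z : ↥(ball (0 : EuclideanSpace ℝ (Fin 4)) 1)) : EuclideanSpace ℝ (Fin 4))
    have hq : Continuous q := D.continuousOn_Ginv.comp_continuous
      (continuous_subtype_val.comp continuous_subtype_val) fun z ↦ z.2.2
    have hq1 : ∀ z, ‖(q z).1‖ < 1 := fun z ↦ (mem_dom_iff.1 (D.Ginv_mem z.2.2)).1
    have hq2 : ∀ z, ‖(q z).2‖ < 2 := fun z ↦ (mem_dom_iff.1 (D.Ginv_mem z.2.2)).2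
    have hq0 : ∀ z, (q z).2 ≠ 0 := fun z ↦ D.Ginv_snd_ne_zero z.2.2 z.2.1
    have hGq : ∀ z, D.G (q z) = ((z : ↥(ball (0 : EuclideanSpace ℝ (Fin 4)) 1)) : EuclideanSpace ℝ (Fin 4)) :=
      fun z ↦ D.G_Ginv z.2.2
    -- the interpolated argument
    let arg : unitInterval × ↥(D.ballU ∩ D.ballT) → EuclideanSpace ℝ (Fin 2) × EuclideanSpace ℝ (Fin 2) := fun p ↦
      (((p.1 : ℝ)) • (q p.2).1, ((p.1 : ℝ) + (1 - (p.1 : ℝ)) * (1 / 2) * ‖(q p.2).2‖⁻¹) • (q p.2).2)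
    have hs : Continuous fun p : unitInterval × ↥(D.ballU ∩ D.ballT) ↦ ((p.1 : ℝ)) :=
      continuous_subtype_val.comp continuous_fst
    have hc1 : Continuous fun p : unitInterval × ↥(D.ballU ∩ D.ballT) ↦ (q p.2).1 :=
      continuous_fst.comp (hq.comp continuous_snd)
    have hc2 : Continuous fun p : unitInterval × ↥(D.ballU ∩ D.ballT) ↦ (q p.2).2 :=
      continuous_snd.comp (hq.comp continuous_snd)
    have hcoefc : Continuous fun p : unitInterval × ↥(D.ballU ∩ D.ballT) ↦
        (p.1 : ℝ) + (1 - (p.1 : ℝ)) * (1 / 2) * ‖(q p.2).2‖⁻¹ :=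
      hs.add (((continuous_const.sub hs).mul continuous_const).mul
        (hc2.norm.inv₀ fun p ↦ (norm_pos_iff.2 (hq0 p.2)).ne'))
    have harg : Continuous arg := (hs.smul hc1).prodMk (hcoefc.smul hc2)
    have hcoef : ∀ p : unitInterval × ↥(D.ballU ∩ D.ballT),
        0 < (p.1 : ℝ) + (1 - (p.1 : ℝ)) * (1 / 2) * ‖(q p.2).2‖⁻¹ := by
      intro p
      have h0 := p.1.2.1
      have h1 := p.1.2.2
      have hw := norm_pos_iff.2 (hq0 p.2)
      rcases eq_or_lt_of_le h0 with h | h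
      · rw [← h]; simp only [sub_zero, one_mul, zero_add]; positivity
      · have : 0 ≤ (1 - (p.1 : ℝ)) * (1 / 2) * ‖(q p.2).2‖⁻¹ := by
          have : 0 ≤ 1 - (p.1 : ℝ) := by linarith
          positivity
        linarith
    have harg1 : ∀ p, ‖(arg p).1‖ < 1 := by
      intro p
      change ‖((p.1 : ℝ)) • (q p.2).1‖ < 1
      rw [norm_smul, Real.norm_of_nonneg p.1.2.1]
      calc (p.1 : ℝ) * ‖(q p.2).1‖ ≤ 1 * ‖(q p.2).1‖ := by gcongr; exact p.1.2.2
        _ < 1 := by rw [one_mul]; exact hq1 p.2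
    have harg2 : ∀ p, ‖(arg p).2‖ < 2 := by
      intro p
      change ‖((p.1 : ℝ) + (1 - (p.1 : ℝ)) * (1 / 2) * ‖(q p.2).2‖⁻¹) • (q p.2).2‖ < 2
      have hw := norm_pos_iff.2 (hq0 p.2)
      rw [norm_smul, Real.norm_of_nonneg (hcoef p).le, add_mul, mul_assoc, inv_mul_cancel₀ hw.ne', mul_one]
      have h1 := p.1.2.2
      have h0 := p.1.2.1
      have := hq2 p.2
      nlinarith
    have harg0 : ∀ p, (arg p).2 ≠ 0 := fun p ↦ smul_ne_zero (hcoef p).ne' (hq0 p.2)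
    refine ⟨{ toFun := fun p ↦ ⟨⟨D.G (arg p), mem_ball_zero_iff.2 (D.norm_G_lt_one (harg1 p) (harg2 p))⟩,
                ⟨D.G_mem_O (harg1 p) (harg2 p) (harg0 p), D.G_mem_N (harg1 p) (harg2 p)⟩⟩
              continuous_toFun := ((D.continuousOn_G.comp_continuous harg fun p ↦
                mem_dom_iff.2 ⟨harg1 p, harg2 p⟩).subtype_mk _).subtype_mk _
              map_zero_left := fun z ↦ ?_
              map_one_left := fun z ↦ ?_ }⟩
    · -- at `s = 0`: the retraction `G(0, ½ w/‖w‖)`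
      apply Subtype.ext; apply Subtype.ext
      change D.G (arg (0, z)) = D.G (0, (1 / 2 : ℝ) • ((radialProjection (spherePt 1) (q z).2 : Metric.sphere (0 : EuclideanSpace ℝ (Fin 2)) 1) : EuclideanSpace ℝ (Fin 2)))
      congr 1
      simp only [arg, Set.Icc.coe_zero, zero_smul, zero_add, sub_zero, one_mul]
      rw [coe_radialProjection_of_ne_zero _ (hq0 z), smul_smul]
    · -- at `s = 1`: the identity
      apply Subtype.ext; apply Subtype.ext
      change D.G (arg (1, z)) = ((z : ↥(ball (0 : EuclideanSpace ℝ (Fin 4)) 1)) : EuclideanSpace ℝ (Fin 4))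
      rw [← hGq z]
      congr 1
      simp only [arg, Set.Icc.coe_one, one_smul, sub_self, zero_mul, add_zero, Prod.mk.eta]
  right_inv := by
    refine ⟨ContinuousMap.Homotopy.refl _ |>.cast ?_ rfl⟩
    ext u : 1
    change u = radialProjection (spherePt 1) (D.Ginv (D.G (0, (1 / 2 : ℝ) • (u : EuclideanSpace ℝ (Fin 2))))).2
    rw [D.Ginv_apply (mem_dom_iff.2 ⟨by simp, by rw [norm_smul_coe_sphere (by norm_num)]; norm_num⟩)]
    exact (radialProjection_smul _ (by norm_num) u).symm

/-- **`H₂` of the punctured tube vanishes** (`U ∩ T ≃ S¹`; Hatcher (2002), Cor. 2.14). [folklore] -/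
theorem isZero_singularHomology_ballU_inter_ballT_two :
    IsZero (singularHomology R M ↥(D.ballU ∩ D.ballT) 2) :=
  (isZero_singularHomology_sphere_holds R M (n := 1) (k := 2) two_ne_zero (by norm_num)).of_iso
    (singularHomology.isoOfHomotopyEquiv R M D.puncturedTubeEquivCircle 2)

/-- **`H₂(B̊⁴ ∖ Δ; M) = 0`** for the exterior piece `U` of the ball: Mayer–Vietoris for
`B̊⁴ = U ∪ T` (`mayerVietoris.exact₁_holds`, Hatcher (2002), §2.2): `H₂(U ∩ T) → H₂(U) ⊕ H₂(T) → H₂(B̊⁴)`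
is exact with outer terms zero. (Alexander duality: `B̊⁴ ∖ Δ` is a homology circle.)
[cite: HatcherAT2002, §2.2 p. 149] -/
theorem isZero_singularHomology_ballU_two : IsZero (singularHomology R M ↥D.ballU 2) := by
  have hex := mayerVietoris.exact₁_holds R M D.ballU D.ballT D.interior_ballU_union_interior_ballT 2
  have hψ : mayerVietoris.ψ R M D.ballU D.ballT 2 = 0 :=
    (isZero_singularHomology_ball R M two_ne_zero).eq_of_tgt _ _
  haveI : Epi (mayerVietoris.φ R M D.ballU D.ballT 2) := hex.epi_f hψ
  have h2 : IsZero (singularHomology R M ↥D.ballU 2 ⊞ singularHomology R M ↥D.ballT 2) :=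
    IsZero.of_epi (mayerVietoris.φ R M D.ballU D.ballT 2) (D.isZero_singularHomology_ballU_inter_ballT_two R M)
  exact h2.of_mono (biprod.inl : singularHomology R M ↥D.ballU 2 ⟶ _)

/-- **the exterior piece of the ball and the open slice-disc exterior are homeomorphic** [folklore] -/
def ballUHomeomorph : ↥D.ballU ≃ₜ ↥(sliceDiscExterior D.g) where
  toFun := D.toExterior
  invFun := D.ofExterior
  left_inv := D.ofExterior_toExterior
  right_inv := D.toExterior_ofExterior
  continuous_toFun := D.toExterior.continuous
  continuous_invFun := D.ofExterior.continuous

/-- **`H₂(B̊⁴ ∖ Δ; M) = 0` for the open slice-disc exterior** of a conical slice disc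
(Manolescu–Piccirillo: `V` has the homology of `B⁴ ∖ Δ`, a homology circle; here from Mayer–Vietoris).
[cite: ManolescuPiccirillo2023, §3.2, proof of Lemma 3.3] -/
theorem isZero_singularHomology_sliceDiscExterior_two :
    IsZero (singularHomology R M ↥(sliceDiscExterior D.g) 2) :=
  (D.isZero_singularHomology_ballU_two R M).of_iso (singularHomology.mapIso R M D.ballUHomeomorph 2).symm

/-- **Mayer–Vietoris: `H₁(U ∩ T) → H₁(U) ⊕ H₁(T)` is injective** since `H₂(B̊⁴) = 0`
(`mayerVietoris.exact₃_holds`, Hatcher (2002), §2.2). [cite: HatcherAT2002, §2.2 p. 149] -/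
theorem mono_mayerVietoris_φ_one : Mono (mayerVietoris.φ R M D.ballU D.ballT 1) := by
  have hexc := relativeSingularHomology.isIso_map_of_interior_union_interior_holds R M
    ↥(ball (0 : EuclideanSpace ℝ (Fin 4)) 1)
  have hδ : mayerVietoris.δ R M D.ballU D.ballT hexc D.interior_ballU_union_interior_ballT 1 = 0 :=
    (isZero_singularHomology_ball R M two_ne_zero).eq_of_src _ _
  exact (mayerVietoris.exact₃_holds R M D.ballU D.ballT hexc D.interior_ballU_union_interior_ballT 1).mono_g hδ

/-- **the meridian as a loop of the punctured tube** `U ∩ T` [folklore] -/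
def meridianUT {x₀ : EuclideanSpace ℝ (Fin 2)} (hx₀ : ‖x₀‖ < 1) :
    Path (⟨(D.basePt hx₀ : ↥(ball (0 : EuclideanSpace ℝ (Fin 4)) 1)), (D.basePt hx₀).2, D.basePt_mem_ballT hx₀⟩ :
      ↥(D.ballU ∩ D.ballT)) ⟨(D.basePt hx₀ : ↥(ball (0 : EuclideanSpace ℝ (Fin 4)) 1)), (D.basePt hx₀).2,
        D.basePt_mem_ballT hx₀⟩ where
  toFun t := ⟨(D.meridianU hx₀ t : ↥(ball (0 : EuclideanSpace ℝ (Fin 4)) 1)), (D.meridianU hx₀ t).2,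
    D.meridianU_mem_ballT hx₀ t⟩
  continuous_toFun := (continuous_subtype_val.comp (D.meridianU hx₀).continuous).subtype_mk _
  source' := Subtype.ext (by
    change ((D.meridianU hx₀ 0 : ↥D.ballU) : ↥(ball (0 : EuclideanSpace ℝ (Fin 4)) 1)) = _
    rw [(D.meridianU hx₀).source])
  target' := Subtype.ext (by
    change ((D.meridianU hx₀ 1 : ↥D.ballU) : ↥(ball (0 : EuclideanSpace ℝ (Fin 4)) 1)) = _
    rw [(D.meridianU hx₀).target])

/-- In `U` the loop `meridianUT` is the meridian. [folklore] -/
theorem meridianUT_map_left {x₀ : EuclideanSpace ℝ (Fin 2)} (hx₀ : ‖x₀‖ < 1) :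
    (D.meridianUT hx₀).map (subsetInclusion (inter_subset_left : D.ballU ∩ D.ballT ⊆ D.ballU)).continuous =
      D.meridianU hx₀ := by
  ext t
  rfl

/-- **the fibre coordinate** of the punctured tube, `G(x, w) ↦ w ∈ ℂ ∖ 0` [folklore] -/
def fibreCoord : C(↥(D.ballU ∩ D.ballT), CStar) where
  toFun z := ⟨toC (D.Ginv ((z : ↥(ball (0 : EuclideanSpace ℝ (Fin 4)) 1)) : EuclideanSpace ℝ (Fin 4))).2,
    toC_ne_zero (D.Ginv_snd_ne_zero z.2.2 z.2.1)⟩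
  continuous_toFun := (continuous_toC.comp (continuous_snd.comp (D.continuousOn_Ginv.comp_continuous
    (continuous_subtype_val.comp continuous_subtype_val) fun z ↦ z.2.2))).subtype_mk _

/-- The fibre coordinate of the meridian at `θ` is `½ e^{2πiθ}`. [folklore] -/
theorem fibreCoord_meridianUT {x₀ : EuclideanSpace ℝ (Fin 2)} (hx₀ : ‖x₀‖ < 1) (θ : unitInterval) :
    (D.fibreCoord (D.meridianUT hx₀ θ) : ℂ) = (windingLoop (1 / 2) one_half_pos 1 θ : ℂ) := by
  have h1 : (D.fibreCoord (D.meridianUT hx₀ θ) : ℂ) =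
      toC (D.Ginv ((((D.meridianU hx₀ θ : ↥D.ballU) : ↥(ball (0 : EuclideanSpace ℝ (Fin 4)) 1)) :
        EuclideanSpace ℝ (Fin 4)))).2 := rfl
  have hdom : ((x₀, Knot.TubularNbhd.fibreVec θ) : EuclideanSpace ℝ (Fin 2) × EuclideanSpace ℝ (Fin 2)) ∈
      (dom : Set (EuclideanSpace ℝ (Fin 2) × EuclideanSpace ℝ (Fin 2))) :=
    mem_dom_iff.2 ⟨hx₀, by rw [Knot.TubularNbhd.norm_fibreVec]; norm_num⟩
  rw [h1, D.coe_meridianU hx₀, D.Ginv_apply hdom, windingLoop_apply_coe, Knot.TubularNbhd.fibreVec, toC_polar]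
  push_cast
  ring_nf

/-- The fibre coordinate of the meridian is the winding loop `t ↦ ½ e^{2πit}` (as singular
`1`-simplices). [folklore] -/
theorem ofPath_meridianUT_map_fibreCoord {x₀ : EuclideanSpace ℝ (Fin 2)} (hx₀ : ‖x₀‖ < 1) :
    ofPath ((D.meridianUT hx₀).map D.fibreCoord.continuous) = ofPath (windingLoop (1 / 2) one_half_pos 1) := by
  apply toContinuousMap_injective
  ext s : 1
  rw [ofPath_apply, ofPath_apply]
  exact Subtype.ext (D.fibreCoord_meridianUT hx₀ _)

/-- **The meridian has infinite order in `H₁(B̊⁴ ∖ Δ; ℤ)`** (exterior piece `U`): `k ↦ k • h(μ)` is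
injective, `h` the Hurewicz class. If `k • h(μ) = 0` in `H₁(U)`, then (as `H₁(T) = 0`) the class
`k • h(μ)` of the punctured tube dies under the injective Mayer–Vietoris map, so it vanishes in
`H₁(U ∩ T)`, and its image under the fibre coordinate is `k •` (winding loop), which is non-zero for
`k ≠ 0` (`loopClass_windingLoop_smul_injective`). (Alexander duality: `μ` generates
`H₁(B̊⁴ ∖ Δ) ≅ ℤ`.) [cite: HatcherAT2002, §2.2 p. 149] -/
theorem smul_loopClass_meridianU_injective {x₀ : EuclideanSpace ℝ (Fin 2)} (hx₀ : ‖x₀‖ < 1) :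
    Function.Injective fun k : ℤ ↦ k • loopClass ℤ ℤ (1 : ℤ) (D.meridianU hx₀) := by
  suffices key : ∀ k : ℤ, k • loopClass ℤ ℤ (1 : ℤ) (D.meridianU hx₀) = 0 → k = 0 by
    intro k l hkl
    have := key (k - l) (by rw [sub_zsmul, add_neg_eq_zero]; exact hkl)
    omega
  intro k hk
  -- the class of the punctured tube dies under the (injective) Mayer–Vietoris map
  haveI := D.mono_mayerVietoris_φ_one ℤ ℤ
  have hinj := (ModuleCat.mono_iff_injective (mayerVietoris.φ ℤ ℤ D.ballU D.ballT 1)).1 inferInstance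
  have hT : loopClass ℤ ℤ (1 : ℤ) ((D.meridianUT hx₀).map
      (subsetInclusion (inter_subset_right : D.ballU ∩ D.ballT ⊆ D.ballT)).continuous) = 0 := by
    haveI := ModuleCat.subsingleton_of_isZero (D.isZero_singularHomology_ballT ℤ ℤ one_ne_zero)
    exact Subsingleton.elim _ _
  have h0 : k • loopClass ℤ ℤ (1 : ℤ) (D.meridianUT hx₀) = 0 := by
    apply hinj
    rw [map_zero]
    refine biprod_apply_ext ?_ ?_
    · rw [map_zero, mayerVietoris.φ, biprod_fst_lift_apply, map_zsmul, map_loopClass,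
        D.meridianUT_map_left hx₀]
      exact hk
    · rw [map_zero, mayerVietoris.φ, biprod_snd_lift_apply]
      change -(singularHomology.map ℤ ℤ (subsetInclusion inter_subset_right) 1
        (k • loopClass ℤ ℤ (1 : ℤ) (D.meridianUT hx₀))) = 0
      rw [map_zsmul, map_loopClass, hT, zsmul_zero, neg_zero]
  -- push along the fibre coordinate: `k •` (winding loop) `= 0` forces `k = 0`
  have h2 := congrArg (singularHomology.map ℤ ℤ D.fibreCoord 1) h0
  rw [map_zsmul, map_zero, map_loopClass,
    loopClass_eq_of_ofPath_eq ℤ ℤ 1 _ _ (D.ofPath_meridianUT_map_fibreCoord hx₀)] at h2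
  exact loopClass_windingLoop_smul_injective (1 / 2) one_half_pos (a₁ := k) (a₂ := 0) (by simpa using h2)

/-- **The meridian has infinite order in `H₁` of the open slice-disc exterior**: `k ↦ k • h(μ)` is
injective on `ℤ`, for the meridian `D.meridian hx₀` of `sliceDiscExterior D.g` (transport of
`smul_loopClass_meridianU_injective` along `U ≅ sliceDiscExterior D.g`).
[cite: ManolescuPiccirillo2023, §3.2, proof of Lemma 3.3] -/
theorem smul_loopClass_meridian_injective {x₀ : EuclideanSpace ℝ (Fin 2)} (hx₀ : ‖x₀‖ < 1) :
    Function.Injective fun k : ℤ ↦ k • loopClass ℤ ℤ (1 : ℤ) (D.meridian hx₀) := by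
  intro k l hkl
  apply D.smul_loopClass_meridianU_injective hx₀
  have h := congrArg (singularHomology.map ℤ ℤ D.ofExterior 1) hkl
  simp only [map_zsmul, map_loopClass] at h
  change k • loopClass ℤ ℤ (1 : ℤ) ((D.meridian hx₀).map D.ofExterior.continuous) =
    l • loopClass ℤ ℤ (1 : ℤ) ((D.meridian hx₀).map D.ofExterior.continuous) at h
  rwa [D.meridian_map_ofExterior hx₀] at h

end Homology

end ConicalDiscTube

end Literature.Topology.FourManifolds
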